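import Summits.ResolutionOfSingularities.ResolutionOfSingularities.Theorems.EquisingularLiftEquisingularLiftNatNDProjChartStalk
import Summits.ResolutionOfSingularities.ResolutionOfSingularities.Theorems.EquisingularLiftEquisingularLiftNatNDChartFrame
import Summits.ResolutionOfSingularities.ResolutionOfSingularities.Theorems.EquisingularLiftEquisingularLiftNatPrescribedGermDivisor
import Literature.AlgebraicGeometry.Resolution.AffineDomainEquidim
import Literature.AlgebraicGeometry.Resolution.ProjectiveSpaceRegular
import HarnessLib

/-!
# Crux EL♮(3) `EquisingularLiftNatThree` (stmt-ResolutionOfSingularities-20148), chain W4.5b — DEAL «ND-K5» brick (B4γ) `ndInv_init`,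
# part 3: THE FRAME OF `ℙⁿ_k` AT A RATIONAL POINT IN THE COORDINATES OF AN ORIGIN-FIXING AUTOMORPHISM

[OURS · L1 W4.5b · EL♮(3) stmt-ResolutionOfSingularities-20148 · (B4γ) sub-brick (γ4) of the feasibility memo · res-type-027 g20, second hand of
the (B4γ) owner res-L1-w45b-nose-w1 (interface request 2026-08-28T15:16:19Z) · helper, `--supports`; def-free; nothing of the manuscript under
review [Hironaka2017] is asserted; AI-written, weaker than expert review]

Setting: `x = chartι k n i y₀ ∈ ℙⁿ_k` with `𝔭_{y₀} = 𝔪_b` the ideal of the rational point `b ∈ kⁿ` of the chart, `χ : k[t] → 𝒪_{ℙⁿ,x}` the chart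
ring map of part 2 (`ND.exists_chartRingHom`: a localisation at `𝔪_b` agreeing with `ND.baseToStalk` on constants), and `θ` an origin-fixing
`k`-algebra automorphism of `k[t]` (`Sections.FixesOrigin`).  THE FRAME: `w_j := χ (qⱼ)` with `qⱼ := (θ⁻¹ tⱼ)(t − b)`
(`Sections.translate (-b) (θ.symm (X j))`).  Then
* `q₁,…,qₙ` generate `𝔪_b` (§1, `span_range_recentre_eq_vanishingIdeal`), so `w` generates the maximal ideal of `𝒪_{ℙⁿ,x}`;
* `g(q) = f` whenever `g = θ (f(t + b))` (§1, `aeval_recentre_localCoords`), so `g(w) = χ f` with coefficients through `ND.baseToStalk` — for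
  `g = Sections.localEquation F a i θ` this is the local equation clause of `ND.IsNDFrameAt`;
* `dim 𝒪_{ℙⁿ,x} = n` (maximal ideals of `k[t₁,…,tₙ]` have height `n`, tree `MvPolynomial.height_eq_of_isMaximal`);
* each `w_j ≠ 0` is the germ at `x` of an ideal sheaf `W_j` on `ℙⁿ_k` with all stalks principal (tree `exists_forall_isPrincipal_stalkIdeal_eq_span`
  on the regular integral scheme `ℙⁿ_k`).
Main statements: `exists_frame` (all clauses, `∀ f`) and `exists_frame_localEquation` (the (B4γ) owner's interface verbatim).

References: R. Hartshorne, *Algebraic Geometry* (1977), II Prop. 2.5, I Thm. 3.4 [Hartshorne1977]; H. Matsumura, *Commutative Ring Theory* (1986),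
§5 Ex. 5.1 [Matsumura1987].
-/

set_option linter.dupNamespace false -- mandated namespace `Summit.<Summit>.<Problem>` of this single-conjunct summit

noncomputable section

open CategoryTheory AlgebraicGeometry TopologicalSpace IsLocalRing MvPolynomial
open Literature.AlgebraicGeometry.Resolution
open Literature.AlgebraicGeometry.Motives

namespace Summit.ResolutionOfSingularities.ResolutionOfSingularities.Cruxes.EquisingularLiftNat.Sections.ND

/-! ## §1 Recentred coordinates: `qⱼ = (θ⁻¹ tⱼ)(t − b)` -/

section Algebra

variable {k : Type} [Field k] {n : ℕ}

/-- Translations compose: `g(t + b)(t + c) = g(t + (b + c))`. [folklore] -/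
theorem translate_translate (b c : Fin n → k) (g : MvPolynomial (Fin n) k) :
    translate c (translate b g) = translate (b + c) g := by
  unfold translate
  rw [← AlgHom.comp_apply, MvPolynomial.comp_aeval]
  have h : (fun i => aeval (fun j => X j + C (c j)) (X i + C (b i))) = fun j => X j + C ((b + c) j) := by
    funext j
    simp only [map_add, aeval_X, algHom_C, algebraMap_eq, Pi.add_apply]
    ring
  rw [h]

/-- `translate 0 = id`. [folklore] -/
theorem translate_zero_vec (g : MvPolynomial (Fin n) k) : translate (0 : Fin n → k) g = g := by
  unfold translate
  simp only [Pi.zero_apply, C_0, add_zero, aeval_X_left, AlgHom.coe_id, id_eq]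

/-- `g(t + b)(t − b) = g`. [folklore] -/
theorem translate_neg_translate (b : Fin n → k) (g : MvPolynomial (Fin n) k) : translate (-b) (translate b g) = g := by
  rw [translate_translate, add_neg_cancel, translate_zero_vec]

/-- `g(t − b)(t + b) = g`. [folklore] -/
theorem translate_translate_neg (b : Fin n → k) (g : MvPolynomial (Fin n) k) : translate b (translate (-b) g) = g := by
  rw [translate_translate, neg_add_cancel, translate_zero_vec]

/-- The value of `g(t + b)` at the origin is `g(b)`: `aeval c (translate b g) = aeval (c + b) g`. [folklore] -/
theorem aeval_translate (b c : Fin n → k) (g : MvPolynomial (Fin n) k) :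
    aeval c (translate b g) = aeval (c + b) g := by
  unfold translate
  rw [← AlgHom.comp_apply, MvPolynomial.comp_aeval]
  have h : (fun i => aeval c (X i + C (b i))) = (c + b) := by
    funext j
    simp only [map_add, aeval_X, aeval_C, Algebra.algebraMap_self, RingHom.id_apply, Pi.add_apply]
  rw [h]

/-- The constant coefficient of `g(t + b)` is `g(b)`. [folklore] -/
theorem constantCoeff_translate (b : Fin n → k) (g : MvPolynomial (Fin n) k) :
    constantCoeff (translate b g) = aeval b g := by
  have h := aeval_translate b 0 g
  rw [zero_add, MvPolynomial.aeval_zero] at h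
  simpa using h

/-- An origin-fixing automorphism preserves constant coefficients. [folklore] -/
theorem constantCoeff_apply_of_fixesOrigin (θ : MvPolynomial (Fin n) k ≃ₐ[k] MvPolynomial (Fin n) k) (hθ : FixesOrigin θ)
    (p : MvPolynomial (Fin n) k) : constantCoeff (θ p) = constantCoeff p :=
  constantCoeff_map_of_fixesOrigin (θ : MvPolynomial (Fin n) k →ₐ[k] MvPolynomial (Fin n) k) hθ p

/-- The inverse of an origin-fixing automorphism fixes the origin. [folklore] -/
theorem fixesOrigin_symm (θ : MvPolynomial (Fin n) k ≃ₐ[k] MvPolynomial (Fin n) k) (hθ : FixesOrigin θ) : FixesOrigin θ.symm := by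
  intro j
  have h := constantCoeff_apply_of_fixesOrigin θ hθ (θ.symm (X j))
  rw [AlgEquiv.apply_symm_apply, constantCoeff_X] at h
  exact h.symm

/-- **`g(q) = f` for `g = θ (f(t + b))` and `qⱼ = (θ⁻¹ tⱼ)(t − b)`**: substituting the recentred inverse coordinates undoes the
coordinate change of `Sections.localEquation`. [folklore] -/
theorem aeval_recentre_localCoords (θ : MvPolynomial (Fin n) k ≃ₐ[k] MvPolynomial (Fin n) k) (b : Fin n → k)
    (f : MvPolynomial (Fin n) k) :
    aeval (fun j => translate (-b) (θ.symm (X j))) (θ (translate b f)) = f := by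
  -- `aeval q` is the `k`-algebra map `translate (-b) ∘ θ⁻¹`
  have hψ : (aeval (fun j => translate (-b) (θ.symm (X j))) : MvPolynomial (Fin n) k →ₐ[k] MvPolynomial (Fin n) k) =
      ((aeval fun j => X j + C ((-b) j)).comp (θ.symm : MvPolynomial (Fin n) k →ₐ[k] MvPolynomial (Fin n) k)) := by
    apply MvPolynomial.algHom_ext
    intro j
    rw [aeval_X, AlgHom.comp_apply]
    rfl
  rw [hψ]
  change translate (-b) (θ.symm (θ (translate b f))) = f
  rw [AlgEquiv.symm_apply_apply]
  exact translate_neg_translate b f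

/-- The recentred inverse coordinates vanish at `b`. [folklore] -/
theorem aeval_recentre_eq_zero (θ : MvPolynomial (Fin n) k ≃ₐ[k] MvPolynomial (Fin n) k) (hθ : FixesOrigin θ) (b : Fin n → k)
    (j : Fin n) : aeval b (translate (-b) (θ.symm (X j))) = 0 := by
  rw [aeval_translate, add_neg_cancel, MvPolynomial.aeval_zero, fixesOrigin_symm θ hθ j, map_zero]

/-- A polynomial vanishing at `b` is a combination of the recentred inverse coordinates: `f = Σ cⱼ qⱼ`. [folklore] -/
theorem mem_span_range_recentre_of_aeval_eq_zero (θ : MvPolynomial (Fin n) k ≃ₐ[k] MvPolynomial (Fin n) k) (hθ : FixesOrigin θ)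
    (b : Fin n → k) {f : MvPolynomial (Fin n) k} (hf : aeval b f = 0) :
    f ∈ Ideal.span (Set.range fun j => translate (-b) (θ.symm (X j))) := by
  classical
  -- `g := θ (f(t + b))` has zero constant coefficient, so `g ∈ (t₁, …, tₙ)`
  set g := θ (translate b f) with hg
  have hg0 : constantCoeff g = 0 := by
    rw [hg, constantCoeff_apply_of_fixesOrigin θ hθ, constantCoeff_translate, hf]
  have hgmem : g ∈ Ideal.span (Set.range (X : Fin n → MvPolynomial (Fin n) k)) := by
    rw [show Set.range (X : Fin n → MvPolynomial (Fin n) k) = X '' Set.univ from Set.image_univ.symm,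
      MvPolynomial.mem_ideal_span_X_image]
    intro m hm
    by_cases hm0 : m = 0
    · rw [hm0, MvPolynomial.mem_support_iff] at hm
      exact absurd hg0 hm
    · obtain ⟨i, hi⟩ := Finsupp.ne_iff.mp hm0
      exact ⟨i, Set.mem_univ i, by simpa using hi⟩
  -- apply the ring map `translate (-b) ∘ θ⁻¹`, which sends `g` to `f` and `tⱼ` to `qⱼ`
  let ψ : MvPolynomial (Fin n) k →+* MvPolynomial (Fin n) k :=
    ((aeval fun j => X j + C ((-b) j)) : MvPolynomial (Fin n) k →ₐ[k] MvPolynomial (Fin n) k).toRingHom.comp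
      (θ.symm : MvPolynomial (Fin n) k →ₐ[k] MvPolynomial (Fin n) k).toRingHom
  have hψ : ∀ p, ψ p = translate (-b) (θ.symm p) := fun p => rfl
  have hψg : ψ g = f := by
    rw [hψ, hg, AlgEquiv.symm_apply_apply, translate_neg_translate]
  have hmap : Ideal.map ψ (Ideal.span (Set.range (X : Fin n → MvPolynomial (Fin n) k))) =
      Ideal.span (Set.range fun j => translate (-b) (θ.symm (X j))) := by
    rw [Ideal.map_span, ← Set.range_comp]
    rfl
  rw [← hψg, ← hmap]
  exact Ideal.mem_map_of_mem ψ hgmem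

/-- **The recentred inverse coordinates generate the ideal of the point `b`**: `(q₁, …, qₙ) = 𝔪_b`. [folklore] -/
theorem span_range_recentre_eq_vanishingIdeal (θ : MvPolynomial (Fin n) k ≃ₐ[k] MvPolynomial (Fin n) k) (hθ : FixesOrigin θ)
    (b : Fin n → k) :
    Ideal.span (Set.range fun j => translate (-b) (θ.symm (X j))) = MvPolynomial.vanishingIdeal k {b} := by
  apply le_antisymm
  · rw [Ideal.span_le]
    rintro _ ⟨j, rfl⟩
    rw [SetLike.mem_coe, MvPolynomial.mem_vanishingIdeal_iff]
    rintro x rfl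
    exact aeval_recentre_eq_zero θ hθ x j
  · intro f hf
    rw [MvPolynomial.mem_vanishingIdeal_iff] at hf
    exact mem_span_range_recentre_of_aeval_eq_zero θ hθ b (hf b rfl)

/-- The recentred inverse coordinates are non-zero. [folklore] -/
theorem recentre_ne_zero (θ : MvPolynomial (Fin n) k ≃ₐ[k] MvPolynomial (Fin n) k) (b : Fin n → k) (j : Fin n) :
    translate (-b) (θ.symm (X j)) ≠ 0 := by
  intro h
  have h2 : θ (translate b (translate (-b) (θ.symm (X j)))) = X j := by
    rw [translate_translate_neg, AlgEquiv.apply_symm_apply]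
  rw [h, show translate b (0 : MvPolynomial (Fin n) k) = 0 from map_zero _, map_zero] at h2
  exact X_ne_zero j h2.symm

end Algebra

/-! ## §2 The frame at a rational point of `ℙⁿ_k` -/

section Frame

variable (k : Type) [Field k] (n : ℕ)

/-- **`dim 𝒪_{ℙⁿ,x} = n` at a point of a chart over a rational point** (`𝒪_{ℙⁿ,x} = k[t]_{𝔪_b}` and `ht 𝔪_b = n`).
[cite: Matsumura1987, §5 Ex. 5.1] -/
theorem ringKrullDim_stalk_eq_of_isLocalization (i : Fin (n + 1)) (b : Fin n → k)
    (y₀ : Spec (CommRingCat.of (MvPolynomial (Fin n) k))) (hy₀ : y₀.asIdeal = MvPolynomial.vanishingIdeal k {b})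
    (χ : MvPolynomial (Fin n) k →+* (projectiveSpace n k).left.presheaf.stalk (ProjectiveSpaceCells.chartι k n i y₀))
    (hχ : letI := χ.toAlgebra
      IsLocalization.AtPrime ((projectiveSpace n k).left.presheaf.stalk (ProjectiveSpaceCells.chartι k n i y₀)) y₀.asIdeal) :
    ringKrullDim ((projectiveSpace n k).left.presheaf.stalk (ProjectiveSpaceCells.chartι k n i y₀)) = (n : WithBot ℕ∞) := by
  letI := χ.toAlgebra
  haveI := hχ
  haveI : y₀.asIdeal.IsMaximal := by rw [hy₀]; infer_instance
  rw [IsLocalization.AtPrime.ringKrullDim_eq_height y₀.asIdeal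
    ((projectiveSpace n k).left.presheaf.stalk (ProjectiveSpaceCells.chartι k n i y₀)),
    Literature.AlgebraicGeometry.Resolution.MvPolynomial.height_eq_of_isMaximal k n y₀.asIdeal]
  rfl

/-- **THE FRAME (all clauses).** At `x = chartι k n i y₀`, `𝔭_{y₀} = 𝔪_b`, with `χ` the chart ring map and `θ` origin-fixing: ideal sheaves
`W₁,…,Wₙ` on `ℙⁿ_k` with all stalks principal and germs `w_j = χ((θ⁻¹ tⱼ)(t − b))` at `x` forming a system of generators of `𝔪_x`,
`dim 𝒪_{ℙⁿ,x} = n`, and `(θ (f(t + b)))(w) = χ f` for every `f ∈ k[t]` (coefficients through `ND.baseToStalk`).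
[cite: Hartshorne1977, II Prop. 2.5; Matsumura1987, §5 Ex. 5.1] -/
theorem exists_frame (i : Fin (n + 1)) (b : Fin n → k)
    (y₀ : Spec (CommRingCat.of (MvPolynomial (Fin n) k))) (hy₀ : y₀.asIdeal = MvPolynomial.vanishingIdeal k {b})
    (χ : MvPolynomial (Fin n) k →+* (projectiveSpace n k).left.presheaf.stalk (ProjectiveSpaceCells.chartι k n i y₀))
    (hχ : letI := χ.toAlgebra
      IsLocalization.AtPrime ((projectiveSpace n k).left.presheaf.stalk (ProjectiveSpaceCells.chartι k n i y₀)) y₀.asIdeal)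
    (hC : χ.comp MvPolynomial.C = baseToStalk n k (𝟙 _) (ProjectiveSpaceCells.chartι k n i y₀))
    (θ : MvPolynomial (Fin n) k ≃ₐ[k] MvPolynomial (Fin n) k) (hθ : FixesOrigin θ) :
    ∃ (W : Fin n → (projectiveSpace n k).left.IdealSheafData)
      (w : Fin n → (projectiveSpace n k).left.presheaf.stalk (ProjectiveSpaceCells.chartι k n i y₀)),
      (∀ j, w j = χ (translate (-b) (θ.symm (X j)))) ∧
      (∀ j z, (stalkIdeal (W j) z).IsPrincipal) ∧
      (∀ j, stalkIdeal (W j) (ProjectiveSpaceCells.chartι k n i y₀) = Ideal.span {w j}) ∧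
      Ideal.span (Set.range w) = maximalIdeal ((projectiveSpace n k).left.presheaf.stalk (ProjectiveSpaceCells.chartι k n i y₀)) ∧
      ringKrullDim ((projectiveSpace n k).left.presheaf.stalk (ProjectiveSpaceCells.chartι k n i y₀)) = (n : WithBot ℕ∞) ∧
      ∀ f : MvPolynomial (Fin n) k,
        MvPolynomial.eval₂ (baseToStalk n k (𝟙 _) (ProjectiveSpaceCells.chartι k n i y₀)) w (θ (translate b f)) = χ f := by
  classical
  letI := χ.toAlgebra
  haveI := hχ
  haveI : IsIntegral (projectiveSpace n k).left := isIntegral_projectiveSpace n k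
  haveI := (isSmoothProjective_projectiveSpace_holds k n).smoothOfRelativeDimension
  haveI : Smooth (projectiveSpace n k).hom := SmoothOfRelativeDimension.smooth n (projectiveSpace n k).hom
  haveI : IsLocallyNoetherian (projectiveSpace n k).left := LocallyOfFiniteType.isLocallyNoetherian (projectiveSpace n k).hom
  -- `χ` is injective (localisation of a domain at a prime)
  have hM : y₀.asIdeal.primeCompl ≤ nonZeroDivisors (MvPolynomial (Fin n) k) :=
    le_nonZeroDivisors_of_noZeroDivisors (fun h => h (Ideal.zero_mem _))
  have hinj : Function.Injective χ := fun a₁ a₂ h12 =>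
    IsLocalization.injective (M := y₀.asIdeal.primeCompl)
      ((projectiveSpace n k).left.presheaf.stalk (ProjectiveSpaceCells.chartι k n i y₀)) hM h12
  have hw0 : ∀ j, χ (translate (-b) (θ.symm (X j))) ≠ 0 := fun j h =>
    recentre_ne_zero θ b j (hinj (by rw [h, map_zero]))
  -- the ideal sheaves: Cartier divisors with the prescribed germs
  choose W hWpr hWx using fun j =>
    exists_forall_isPrincipal_stalkIdeal_eq_span (isRegular_projectiveSpace n k) (ProjectiveSpaceCells.chartι k n i y₀) (hw0 j)
  refine ⟨W, fun j => χ (translate (-b) (θ.symm (X j))), fun j => rfl, hWpr, hWx, ?_,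
    ringKrullDim_stalk_eq_of_isLocalization k n i b y₀ hy₀ χ hχ, fun f => ?_⟩
  · -- `(w) = 𝔪_x`
    have h1 : Ideal.span (Set.range fun j => χ (translate (-b) (θ.symm (X j)))) =
        (Ideal.span (Set.range fun j => translate (-b) (θ.symm (X j)))).map χ := by
      rw [Ideal.map_span, ← Set.range_comp]
      rfl
    rw [h1, span_range_recentre_eq_vanishingIdeal θ hθ b, ← hy₀]
    exact IsLocalization.AtPrime.map_eq_maximalIdeal y₀.asIdeal
      ((projectiveSpace n k).left.presheaf.stalk (ProjectiveSpaceCells.chartι k n i y₀))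
  · -- `g(w) = χ f`
    have h1 : MvPolynomial.eval₂ (baseToStalk n k (𝟙 _) (ProjectiveSpaceCells.chartι k n i y₀))
          (fun j => χ (translate (-b) (θ.symm (X j)))) (θ (translate b f)) =
        χ (MvPolynomial.eval₂ MvPolynomial.C (fun j => translate (-b) (θ.symm (X j))) (θ (translate b f))) := by
      rw [← hC]
      exact (MvPolynomial.eval₂_comp_left χ MvPolynomial.C _ _).symm
    rw [h1, ← MvPolynomial.algebraMap_eq, ← MvPolynomial.aeval_def, aeval_recentre_localCoords θ b f]

/-- **THE FRAME — the (B4γ) owner's interface** (res-L1-w45b-nose-w1, 2026-08-28T15:16:19Z): clauses 1–3 of `ND.IsNDFrameAt` at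
`x = chartι k n i y₀` and the element identity `(θ (f(t + b)))(w) = χ f` (for `f = dehomogenize i F` and `b j = a (i.succAbove j) / a i` the left
side is `(Sections.localEquation F a i θ)(w)`). [cite: Hartshorne1977, II Prop. 2.5; Matsumura1987, §5 Ex. 5.1] -/
theorem exists_frame_localEquation (i : Fin (n + 1)) (b : Fin n → k)
    (y₀ : Spec (CommRingCat.of (MvPolynomial (Fin n) k))) (hy₀ : y₀.asIdeal = MvPolynomial.vanishingIdeal k {b})
    (χ : MvPolynomial (Fin n) k →+* (projectiveSpace n k).left.presheaf.stalk (ProjectiveSpaceCells.chartι k n i y₀))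
    (hχ : letI := χ.toAlgebra
      IsLocalization.AtPrime ((projectiveSpace n k).left.presheaf.stalk (ProjectiveSpaceCells.chartι k n i y₀)) y₀.asIdeal)
    (hC : χ.comp MvPolynomial.C = baseToStalk n k (𝟙 _) (ProjectiveSpaceCells.chartι k n i y₀))
    (θ : MvPolynomial (Fin n) k ≃ₐ[k] MvPolynomial (Fin n) k) (hθ : FixesOrigin θ) (f : MvPolynomial (Fin n) k) :
    ∃ (W : Fin n → (projectiveSpace n k).left.IdealSheafData)
      (w : Fin n → (projectiveSpace n k).left.presheaf.stalk (ProjectiveSpaceCells.chartι k n i y₀)),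
      (∀ j, stalkIdeal (W j) (ProjectiveSpaceCells.chartι k n i y₀) = Ideal.span {w j}) ∧
      Ideal.span (Set.range w) = maximalIdeal ((projectiveSpace n k).left.presheaf.stalk (ProjectiveSpaceCells.chartι k n i y₀)) ∧
      ringKrullDim ((projectiveSpace n k).left.presheaf.stalk (ProjectiveSpaceCells.chartι k n i y₀)) = (n : WithBot ℕ∞) ∧
      MvPolynomial.eval₂ (baseToStalk n k (𝟙 _) (ProjectiveSpaceCells.chartι k n i y₀)) w (θ (translate b f)) = χ f := by
  obtain ⟨W, w, -, -, hWx, hmax, hdim, hloc⟩ := exists_frame k n i b y₀ hy₀ χ hχ hC θ hθ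
  exact ⟨W, w, hWx, hmax, hdim, hloc f⟩

end Frame

end Summit.ResolutionOfSingularities.ResolutionOfSingularities.Cruxes.EquisingularLiftNat.Sections.ND

end
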